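import Literature.Analysis.FluidPDE.DissipationWavenumber
import Literature.Analysis.FluidPDE.CheskidovShvydkoyRegular
import Literature.Analysis.FluidPDE.ClassicalSolution
import Literature.Analysis.FluidPDE.NSWave0
import HarnessLib

/-!
# Cheskidov–Dai's low-mode regularity criterion: the LEVEL-OCCUPATION integral below the
# dissipation wavenumber (named fact)

Analysis/FluidPDE literature file. Source: A. Cheskidov, M. Dai, *Regularity criteria for the 3D
Navier–Stokes and MHD equations*, arXiv:1507.06611 (2015) = Proc. Edinburgh Math. Soc. (2025),
doi:10.1017/s0013091525100813 [CheskidovDai2015]. Navier–Stokes case (`b ≡ 0`, `r = ∞`).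

With the Littlewood–Paley blocks `u_q = Δ_q u`, `λ_q = 2^q`, and the dissipation wavenumber of
Cheskidov–Shvydkoy 2014 (tree: `Literature.Analysis.FluidPDE.dissipationWavenumber`, here at `r = ∞`:
`Λ(t) = min{λ_q : λ_p⁻¹‖u_p(t)‖_∞ < c ν ∀ p > q, q ∈ ℕ}`, `λ_{Q(t)} = Λ(t)`), the paper's main theorem
(§1, "Our main result states as follows", printed for the MHD system; `2 ≤ r ≤ ∞` allowed when `b ≡ 0`):

> **Theorem 1.1.** Let `(u, b)` be a weak solution to (MHD) on `[0,T]`. Assume that `(u(t), b(t))` is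
> regular on `(0,T)`, and `limsup_{q → ∞} ∫_{T/2}^T 1_{q ≤ Q(τ)} λ_q ‖u_q(τ)‖_∞ dτ ≤ c_r`, with some
> `2 ≤ r < 6` (`2 ≤ r ≤ ∞` when `b ≡ 0`). Then `(u(t), b(t))` is regular on `(0,T]`.

("regular on an interval `I`": `‖u(t)‖_{H^s}` continuous on `I` for some `s > 1/2`, Def. 2.6; `c_r` "an
adimensional constant that depends only on `r`", chosen small in the proof, and "the result still holds
if we decrease either `c_r` or `c̃_r`. Hence, they can be chosen equal", end of §3.1.) The paper shows
(Thm. 1.2) that this is weaker than the extended Beale–Kato–Majda condition, than every Prodi–Serrin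
condition, and than Cheskidov–Shvydkoy's `B^{-1}_{∞,∞}`-jump and `Λ ∈ L^∞` criteria (tree:
`cheskidov_shvydkoy_inhom_holds`, `regular_of_dissipationWavenumber_le`).

RENDERING (the house pattern of the tree's continuation criteria for classical solutions, e.g.
`BeiraoDaVeiga1995_vorticityCriterion`, and of `cheskidov_shvydkoy_dyadic`):
* the solution class "weak solution on `[0,T]`, regular on `(0,T)`" is rendered by the cell's classical
  Leray–Hopf solutions: `(u, p)` classical on `ℝ³ × [0,T)` (`IsClassicalNSSolutionOn (Ico 0 T)`), Leray–Hopf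
  on `[0,T]` from the rapidly decaying datum `u 0` (`IsLerayHopfOn T ν 0 (u 0) u`, `HasRapidSpatialDecay`)
  — a special case of the printed hypotheses;
* "regular on `(0,T]`", i.e. no blow-up at `T` (§3.1: "In order to prove that `(u,b)` does not blow up
  at `T`, it is sufficient to show that `‖u(t)‖_{H^s} + ‖b(t)‖_{H^s}` is bounded on `[T/2,T)`"), is
  rendered as `HasSmoothExtensionPast ν 0 u T` (classical continuation past `T`, as in the tree's
  Beirão da Veiga / Chae–Choe criteria);
* the blocks are the tree's homogeneous Littlewood–Paley blocks `Δ̇_q` (`FunctionSpaces.blockFn`) and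
  `Λ` is `dissipationWavenumber c ν` (threshold `c ν 2^q` on `‖Δ̇_q u‖_∞`, the `r = ∞` wavenumber of the
  paper), so `1_{q ≤ Q(τ)} = 1_{2^q ≤ Λ(u(τ))}`; as for `cheskidov_shvydkoy_dyadic` the choice of dyadic
  partition only moves the (existential, absolute) constant `c`;
* the time integral is the lower Lebesgue integral over `(T/2, T)` of the `[0,∞]`-valued integrand
  `1_{2^q ≤ Λ(u(τ))} · 2^q ‖Δ̇_q u(τ)‖_∞` (no measurability of `τ ↦ Λ(u(τ))` asserted), and `limsup_q` is
  taken in `[0,∞]`.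

Cascade reading (why the cell `pub-fluidc` wants it; hedged): a blow-up at `T` needs, at infinitely many
levels `q`, an occupation `∫_{Λ ≥ 2^q} 2^q ‖Δ̇_q u‖_∞ dt > c` during the last half of the lifespan — level
velocity × wavenumber × residence time of the front at or above the level bounded below, the necessity
behind the "spec clock" `T_n ≳ c/(k_n U_n)` of HOME/PLAN.md §0; see
`Summits/NavierStokesRegularity/FluidComputer/LevelOccupationFloor.lean` for the typed contrapositive.

AS-PRINTED TWIN (appended; asked for by the cell's p2 seat, STATUS 2026-08-23 09:05Z, so that the
criterion can be localised to terminal windows `(t₀, T)` by RESTARTING the solution at `t₀` — the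
house rendering's `HasRapidSpatialDecay (u 0)` does not propagate to `u t₀`):
`cheskidov_dai_occupation_regular` keeps the paper's own solution class — a weak solution on `[0,T]`
(here Leray–Hopf, `IsLerayHopfOn T ν 0 u₀ u`, at least as strong as Def. 2.5) which is REGULAR ON
`(0,T)` in the instance `s = 1` of Def. 2.6 (`IsH1RegularOn (Ioo 0 T) u`: `‖u(t)‖_{H¹}` finite and
continuous, the tree's rendering of Cheskidov–Shvydkoy's "regular", used by
`cheskidov_shvydkoy_dyadic_regular`) — and concludes `IsH1RegularOn (Ioc 0 T) u` ("regular on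
`(0,T]`"; the paper's conclusion is `H^s`-continuity on `(0,T]` for some `s > 1/2`, which for a
Leray–Hopf solution regular on `(0,T)` is `H¹`-regularity on `(0,T]` by Leray's continuation theorem,
Cheskidov–Shvydkoy 2010 Thm. 2.4 = the paper's [CS10], exactly the convention of
`cheskidov_shvydkoy_dyadic_regular`). Both hypotheses restrict to subintervals and survive restarts
(`IsH1RegularOn.mono`, `IsH1RegularOn.comp_add_right`, `LerayHopfRestart`), so this form gives the
occupation floor on every terminal window. The two renderings are twins of ONE printed theorem (as
`cheskidov_shvydkoy_dyadic` / `cheskidov_shvydkoy_dyadic_regular` are); neither is derived from the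
other here (the bridges classical+decay ⇒ `H¹`-regular on `(0,T)` and `H¹`-regular at `T` ⇒ smooth
extension past `T` are the local strong-solution theory, not restated).

STATUS: named facts (not proved here). A discharge would redo the tree's Cheskidov–Shvydkoy 2010 a priori
estimate (`IsSmoothSlabSolution.dyadicF_le_exp`, fixed cut `J`) with the time-dependent cut `Q(t)` and the
integrated low-mode factor `f(t) = ∑_{q ≤ Q(t)} λ_q‖u_q‖_∞` of §3.1 (H^s energy estimate, Bony
paraproducts, Grönwall split at `q*`) — size L/XL.

## References

* A. Cheskidov, M. Dai, arXiv:1507.06611 = Proc. Edinburgh Math. Soc. (2025),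
  doi:10.1017/s0013091525100813: §1 Thm. 1.1 (main theorem) and Thm. 1.2, Def. 2.6, §3 (3.1)–(3.2) and
  §3.1 (proof). [CheskidovDai2015]
* A. Cheskidov, R. Shvydkoy, J. Math. Fluid Mech. 16 (2014) 263–273 = arXiv:1102.1944, §3 (`Λ`).
  [CheskidovShvydkoy2011]
-/

noncomputable section

open MeasureTheory Filter Set Function
open scoped ENNReal NNReal

namespace Literature.Analysis.FluidPDE

open FunctionSpaces

/-- **Cheskidov–Dai's level-occupation regularity criterion** (arXiv:1507.06611 = Proc. Edinburgh
Math. Soc. 2025, §1 Thm. 1.1, Navier–Stokes case `b ≡ 0`, `r = ∞`: "Let `u` be a weak solution on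
`[0,T]`. Assume that `u(t)` is regular on `(0,T)`, and
`limsup_{q → ∞} ∫_{T/2}^T 1_{q ≤ Q(τ)} λ_q ‖u_q(τ)‖_∞ dτ ≤ c`. Then `u(t)` is regular on `(0,T]`",
`λ_{Q(τ)} = Λ(τ)` the dissipation wavenumber with threshold `c ν`, `c` an absolute constant), in the
house rendering of the tree's continuation criteria (module docstring, §RENDERING): there is an absolute
`c > 0` such that for all `ν > 0`, `T > 0`, every classical solution `(u, p)` of the unforced
Navier–Stokes system on `ℝ³ × [0,T)` which is Leray–Hopf on `[0,T]` from the rapidly decaying datum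
`u 0`, IF `limsup_{q → ∞} ∫_{(T/2,T)} 1_{2^q ≤ Λ_{c,ν}(u(τ))} 2^q ‖Δ̇_q u(τ)‖_∞ dτ ≤ c` THEN `u` extends to a
classical solution past `T`. [cite: CheskidovDai2015, §1 Thm. 1.1 (case b ≡ 0, r = ∞)] -/
def cheskidov_dai_occupation : Prop :=
  ∃ c : ℝ, 0 < c ∧ ∀ (ν T : ℝ), 0 < ν → 0 < T →
    ∀ (u : ℝ → EuclideanSpace ℝ (Fin 3) → EuclideanSpace ℝ (Fin 3))
      (p : ℝ → EuclideanSpace ℝ (Fin 3) → ℝ),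
      IsClassicalNSSolutionOn (Ico 0 T) ν 0 u p → IsLerayHopfOn T ν 0 (u 0) u →
      HasRapidSpatialDecay (u 0) →
      limsup (fun q : ℕ => ∫⁻ τ in Ioo (T / 2) T,
          {τ | (2 : ℝ≥0∞) ^ q ≤ dissipationWavenumber c ν (u τ)}.indicator
            (fun τ => (2 : ℝ≥0∞) ^ q * eLpNorm (blockFn (q : ℤ) (u τ)) ∞ volume) τ) atTop ≤
        ENNReal.ofReal c →
      HasSmoothExtensionPast ν 0 u T

/-- **Cheskidov–Dai's level-occupation regularity criterion, as printed** (arXiv:1507.06611 =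
Proc. Edinburgh Math. Soc. 2025, §1 Thm. 1.1, Navier–Stokes case `b ≡ 0`, `r = ∞`): "Let `u` be a
weak solution to (NSE) on `[0,T]`. Assume that `u(t)` is regular on `(0,T)`, and
`limsup_{q → ∞} ∫_{T/2}^T 1_{q ≤ Q(τ)} λ_q ‖u_q(τ)‖_∞ dτ ≤ c`. Then `u(t)` is regular on `(0,T]`"
(Def. 2.5: weak solution `= C_w([0,T];L²) ∩ L²(0,T;H¹)` solving the weak form; Def. 2.6: "regular on
`I`" `=` `‖u(t)‖_{H^s}` continuous on `I` for some `s > 1/2`; `λ_{Q(τ)} = Λ(τ)` the dissipation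
wavenumber with threshold `c ν`; `c` absolute, "they can be chosen equal", end of §3.1). Rendering
(module docstring, §AS-PRINTED TWIN): there is an absolute `c > 0` such that for all `ν > 0`, `T > 0`,
every Leray–Hopf weak solution `u` of the unforced system on `ℝ³ × [0,T]` from `u₀`
(`IsLerayHopfOn`, at least as strong as Def. 2.5) which is `H¹`-regular on `(0,T)` (the instance
`s = 1` of "regular on `(0,T)`") and satisfies
`limsup_{q → ∞} ∫_{(T/2,T)} 1_{2^q ≤ Λ_{c,ν}(u(τ))} 2^q ‖Δ̇_q u(τ)‖_∞ dτ ≤ c` is `H¹`-regular on `(0,T]`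
("regular on `(0,T]`", in the `H¹` convention of `cheskidov_shvydkoy_dyadic_regular`: the printed
`H^s`-regularity at `T`, `s > 1/2`, upgraded by Leray's continuation theorem, Cheskidov–Shvydkoy 2010
Thm. 2.4). No decay or classical-smoothness hypothesis: both hypotheses restrict to `(t₀, T)` and
survive Leray–Hopf restarts, so the criterion applies on every terminal window. [cite: CheskidovDai2015, §1 Thm. 1.1 (case b ≡ 0, r = ∞); Def. 2.5, Def. 2.6] -/
def cheskidov_dai_occupation_regular : Prop :=
  ∃ c : ℝ, 0 < c ∧ ∀ (ν T : ℝ), 0 < ν → 0 < T →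
    ∀ (u₀ : EuclideanSpace ℝ (Fin 3) → EuclideanSpace ℝ (Fin 3))
      (u : ℝ → EuclideanSpace ℝ (Fin 3) → EuclideanSpace ℝ (Fin 3)),
      IsLerayHopfOn T ν 0 u₀ u → IsH1RegularOn (Ioo 0 T) u →
      limsup (fun q : ℕ => ∫⁻ τ in Ioo (T / 2) T,
          {τ | (2 : ℝ≥0∞) ^ q ≤ dissipationWavenumber c ν (u τ)}.indicator
            (fun τ => (2 : ℝ≥0∞) ^ q * eLpNorm (blockFn (q : ℤ) (u τ)) ∞ volume) τ) atTop ≤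
        ENNReal.ofReal c →
      IsH1RegularOn (Ioc 0 T) u

end Literature.Analysis.FluidPDE

end
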